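import Literature.MathematicalPhysics.StatisticalMechanics.ComplexSpinExponentialSchwarz
import Literature.Probability.LatticeModels.ChessboardEstimateEvenTorus
import HarnessLib

/-!
# The chessboard argument for the complex spin systems: homogeneous configurations and the
# maximiser form of the multiple-reflection bound (Salmhofer–Seiler, CMP 139 (1991), proof of
# Thm. 3.21: (3.79)–(3.80), (3.85), (3.89)–(3.96))

Companion of `ComplexSpinReflectionPositivity` (Prop. 3.15, Rem. 3.16) and
`ComplexSpinExponentialSchwarz` (Thm. 3.20).  Third instalment of the discharge of the cited fact
`SalmhoferSeiler1991_infraredBound` along the printed proof (pp. 413–415); PROVED here, no named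
fact introduced.  Honest framing: finite-volume algebra of polynomial "spin systems" at `β = 0`;
nothing about `β > 0`, the continuum, or the summit's `QCD` conjunct.

WHAT IS PRINTED (pp. 413–414).  (3.79) `H^ε_Λ(φ) = (ε/2) ∑_{x,μ} ((σ_x - φ_x) - ε(σ_{x+e_μ} -
φ_{x+e_μ}))²`, `φ : Λ → ℂ`, `ε ∈ {-1, 1}`; (3.80) `Z^ε_Λ(φ) = [e^{-N H^ε_Λ(φ)}]_Λ` for the
background bracket (3.78); (3.85) `H^ε` splits into `εν ∑_x (σ_x - φ_x)²` minus the link terms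
`∑_{x,μ} (σ_x - φ_x)(σ_{x+e_μ} - φ_{x+e_μ})`; (3.89)–(3.93): "`F_ε(φ^{(0)}, …, φ^{(L_1-1)}) =
Z^ε_Λ(φ)` defines a function which fulfills cyclicity … Using Theorem 3.20 … one sees that
`|F_ε(φ^{(0)},…)|² ≤ F_ε(φ^{(0)},…,φ^{(L_1/2-1)}, conj φ^{(L_1/2-1)},…, conj φ^{(0)}) F_ε(conj φ…)`
(3.90), so the abstract chessboard bounds [19] apply (with the involution defined as complex
conjugation) … Repetition of this argument for all other directions implies that `|Z^ε_Λ(φ)| ≤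
∏_x Z^ε_Λ(Φ^{(x)})^{1/|Λ|}` (3.92), where `Φ^{(x)}_y = φ_x` if `y ∈ Λ_e`, `conj φ_x` if `y ∈ Λ_o`
(3.93).  For `ε = 1`, take `φ_x ∈ ℝ` for all `x`, then `Φ^{(x)}` is a constant configuration, and
`H⁺_Λ(Φ^{(x)}) = H⁺_Λ(0)` (3.94) … For `ε = -1`, take `φ_x ∈ iℝ`, then `Φ^{(x)}` is a staggered
configuration.  Since `H⁻_Λ` is formally antiferromagnetic, `Z⁻_Λ(Φ^{(x)}) = Z_Λ` (3.96)."

HOW IT IS TYPED.  `-N H^ε_Λ(φ)` is the observable `negNHam ε N φ` (3.79) and, equivalently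
(`sum_hamFamily`, (3.85)), the sum of the family `hamFamily ε N φ` of site terms
`-Nεν(σ_x - φ_x)²` and link terms `N(σ_x - φ_x)(σ_{x+e_μ} - φ_{x+e_μ})` over `Λ ⊕ (Λ × Fin ν)`;
`Z^ε_Λ(φ) = twistedZ ε N f b φ` is the exponential bracket (`expBracketC` of
`ComplexSpinExponentialSchwarz`) of that family for the background bracket with site data `f` and
bond data `b`, i.e. (`twistedZ_eq`) `e^{k₀} [e_D^{K - k₀}]_Λ` with `K = -N H^ε_Λ(φ)`, `k₀` its
constant term, `D = N·|Λ|` — for which the truncated exponential of a sum is the product of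
truncated exponentials modulo observables invisible to the bracket (`NullEq`, `eT_sum_nullEq`).
The homogeneous configuration (3.93) is `pattern` (value `c` on one parity class of the even torus,
`conj c` on the other; `parity` via `ZMod.castHom`); the symmetrised configurations of (3.90) are
`cfgSymP`/`cfgSymM`.  The chessboard bound is typed in MAXIMISER form over the finite set of
configurations with values in a conjugation-closed finite set `S ⊂ ℂ` (`chessboard_cfg`): if
`F ≥ 0` satisfies the reflection Schwarz inequalities `F(ψ)² ≤ F(ψ₊-sym) F(ψ₋-sym)` for all
planes then `F(φ) ≤ F(Φ^{(c)})` for some `c ∈ S` — which is what (3.92) is used for; the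
run-doubling geometry is the tree's (`axisRun`, `boxRun`, `mem_axisRun_succ`,
`boxRun_succ_subset_symP` of the even-torus chessboard files).

WHAT IS PROVED (0 sorry, no new `def … : Prop`).
* `NullEq` (congruence modulo monomials of degree `> D`, an ideal), `bracketC_congr_of_nullEq`;
  `eT_add_eq`, `eT_add_nullEq`, `eT_sum_nullEq` (`e_D^{∑ Q} ≡ ∏ e_D^{Q}`), `expBracketC_one_eq`.
* `sum_hamFamily` ((3.79) = (3.85)), `twistedZ_eq` ((3.80) through `-N H^ε_Λ(φ)`).
* `parity_add_single`, `parity_siteReflect`, `pattern_add_pattern_neighbour`, `pattern_siteReflect`;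
  **(3.94)** `negNHam_one_const`/`twistedZ_one_const` and **(3.96)**
  `negNHam_negOne_pattern`/`twistedZ_negOne_pattern`.
* `symP_agree_subset`/`symM_agree_subset`, `isMax_cfgSymP`, `exists_isMax_axisRun_succ_cfg`,
  `exists_isMax_boxRun_succ_cfg`, **`chessboard_cfg`** ((3.91)–(3.93) in maximiser form).
* Helpers for the per-plane split (3.84)–(3.88): `cst_reflect`, `tail_reflect`, `reflect_expFactor`,
  `cfgSymP_of_mem*`, `cfgSymM_of_mem*`, `linkTerm_eq_crossExp`/`'` (the crossing links are
  `N · C_x · ΘD_x`, (3.87)–(3.88)).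
Not yet here: the identification of `Z^ε_Λ(φ)` and of the two factors of (3.90) as exponential
brackets `[X ΘY e^{∑ N C_x ΘD_x}]` per plane ((3.84)–(3.88)), hence (3.95)/(3.97) themselves —
the next file of the series.

## References

* M. Salmhofer, E. Seiler, *Proof of chiral symmetry breaking in strongly coupled lattice gauge
  theory*, Commun. Math. Phys. 139 (1991) 395–432, (3.79)–(3.96), pp. 413–414. [SalmhoferSeiler1991]
* J. Fröhlich, R. Israel, E. H. Lieb, B. Simon, Commun. Math. Phys. 62 (1978) 1–34 (the paper's
  [19]: abstract chessboard bounds). [FrohlichIsraelLiebSimon1978]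
-/
noncomputable section

open MvPolynomial Finset

namespace Literature.MathematicalPhysics.StatisticalMechanics

open Literature.Probability.LatticeModels (TorusSite)
open Literature.Barriers.CriticalPhenomena.NonGibbs

namespace ComplexSpin

variable {ν L : ℕ}

/-! ### Null observables and congruence modulo null observables -/

/-- `P` and `P'` are congruent modulo null observables of order `D`: every monomial of `P - P'`
has total degree `> D`.  For `D = N·|Λ|` congruent observables have the same brackets
`[R · P]_Λ = [R · P']_Λ` (Remark 3.2). [cite: SalmhoferSeiler1991, Remark 3.2] -/
def NullEq (D : ℕ) (P P' : FieldAlg ν L) : Prop := MinDegree (D + 1) (P - P')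

namespace NullEq

variable {D : ℕ}

/-- Reflexivity. [cite: SalmhoferSeiler1991, Remark 3.2] -/
theorem refl (P : FieldAlg ν L) : NullEq D P P := by
  intro m hm; simp at hm

/-- Symmetry. [cite: SalmhoferSeiler1991, Remark 3.2] -/
theorem symm {P P' : FieldAlg ν L} (h : NullEq D P P') : NullEq D P' P := by
  intro m hm
  have : m ∈ (P - P').support := by
    rw [show P - P' = -(P' - P) by ring, support_neg]; exact hm
  exact h m this

/-- Transitivity. [cite: SalmhoferSeiler1991, Remark 3.2] -/
theorem trans {P P' P'' : FieldAlg ν L} (h : NullEq D P P') (h' : NullEq D P' P'') :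
    NullEq D P P'' := by
  have := MinDegree.add h h'
  rwa [show P - P' + (P' - P'') = P - P'' by ring] at this

/-- Compatibility with addition. [cite: SalmhoferSeiler1991, Remark 3.2] -/
theorem add {P P' Q Q' : FieldAlg ν L} (h : NullEq D P P') (h' : NullEq D Q Q') :
    NullEq D (P + Q) (P' + Q') := by
  have := MinDegree.add h h'
  rwa [show P - P' + (Q - Q') = P + Q - (P' + Q') by ring] at this

/-- Compatibility with multiplication (null observables form an ideal).
[cite: SalmhoferSeiler1991, Remark 3.2] -/
theorem mul {P P' Q Q' : FieldAlg ν L} (h : NullEq D P P') (h' : NullEq D Q Q') :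
    NullEq D (P * Q) (P' * Q') := by
  have h1 : MinDegree (D + 1) ((P - P') * Q) := h.mul_right Q
  have h2 : MinDegree (D + 1) (P' * (Q - Q')) := h'.mul_left P'
  have := h1.add h2
  rwa [show (P - P') * Q + P' * (Q - Q') = P * Q - P' * Q' by ring] at this

/-- A null observable is congruent to `0`. [cite: SalmhoferSeiler1991, Remark 3.2] -/
theorem of_minDegree {P : FieldAlg ν L} (h : MinDegree (D + 1) P) : NullEq D P 0 := by
  simpa [NullEq] using h

/-- Compatibility with finite products. [cite: SalmhoferSeiler1991, Remark 3.2] -/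
theorem prod {α : Type*} {s : Finset α} {g g' : α → FieldAlg ν L}
    (h : ∀ a ∈ s, NullEq D (g a) (g' a)) : NullEq D (∏ a ∈ s, g a) (∏ a ∈ s, g' a) := by
  classical
  induction s using Finset.induction_on with
  | empty => simpa using refl (1 : FieldAlg ν L)
  | insert a s ha ih =>
    rw [Finset.prod_insert ha, Finset.prod_insert ha]
    exact (h a (Finset.mem_insert_self a s)).mul (ih fun x hx => h x (Finset.mem_insert_of_mem hx))

/-- Compatibility with finite sums. [cite: SalmhoferSeiler1991, Remark 3.2] -/
theorem sum {α : Type*} {s : Finset α} {g g' : α → FieldAlg ν L}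
    (h : ∀ a ∈ s, NullEq D (g a) (g' a)) : NullEq D (∑ a ∈ s, g a) (∑ a ∈ s, g' a) := by
  classical
  induction s using Finset.induction_on with
  | empty => simpa using refl (0 : FieldAlg ν L)
  | insert a s ha ih =>
    rw [Finset.sum_insert ha, Finset.sum_insert ha]
    exact (h a (Finset.mem_insert_self a s)).add (ih fun x hx => h x (Finset.mem_insert_of_mem hx))

end NullEq

variable [NeZero L]

/-- **Congruent observables have the same brackets** (at `D = N·|Λ|`).
[cite: SalmhoferSeiler1991, Remark 3.2] -/
theorem bracketC_congr_of_nullEq {N : ℕ} (f b : ℕ → ℝ) {P P' : FieldAlg ν L}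
    (h : NullEq (topDegree ν L N) P P') (R : FieldAlg ν L) :
    bracketC N f b (R * P) = bracketC N f b (R * P') := by
  have h0 : bracketC N f b (R * (P - P')) = 0 :=
    bracketC_eq_zero_of_minDegree f b (MinDegree.mul_left R h)
  rw [mul_sub, bracketC_sub] at h0
  exact sub_eq_zero.1 h0

/-! ### Multiplicativity of the truncated exponential modulo null observables -/

omit [NeZero L] in
/-- **Binomial re-expansion with two observables**:
`e_M^{P + T} = ∑_{l ≤ M} e_{M-l}^{P} T^l / l!` (exact). [cite: SalmhoferSeiler1991, Thm. 3.20 (proof)] -/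
theorem eT_add_eq (M : ℕ) (P T : FieldAlg ν L) :
    eT M (P + T) = ∑ l ∈ range (M + 1), C ((l.factorial : ℂ)⁻¹) * (eT (M - l) P * T ^ l) := by
  unfold eT
  have hbin : ∀ n : ℕ, (P + T) ^ n =
      ∑ l ∈ range (n + 1), T ^ l * P ^ (n - l) * ((n.choose l : ℕ) : FieldAlg ν L) := by
    intro n; rw [add_comm]; exact add_pow T P n
  simp_rw [hbin, Finset.mul_sum]
  rw [Finset.sum_comm' (t' := range (M + 1)) (s' := fun l => Ico l (M + 1))]
  · refine Finset.sum_congr rfl fun l hl => ?_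
    have hlM : l ≤ M := Nat.lt_succ_iff.1 (Finset.mem_range.1 hl)
    rw [Finset.sum_Ico_eq_sum_range, show M + 1 - l = M - l + 1 by omega, Finset.sum_mul,
      Finset.mul_sum]
    refine Finset.sum_congr rfl fun m _ => ?_
    rw [Nat.add_sub_cancel_left, ← map_natCast C]
    have hchoose : (((l + m).choose l : ℕ) : ℂ) * (((l + m).factorial : ℂ)⁻¹) =
        ((l.factorial : ℂ)⁻¹) * ((m.factorial : ℂ)⁻¹) := by
      rw [Nat.cast_add_choose]
      have h1 : ((l + m).factorial : ℂ) ≠ 0 := Nat.cast_ne_zero.2 (Nat.factorial_ne_zero _)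
      have h2 : (l.factorial : ℂ) ≠ 0 := Nat.cast_ne_zero.2 (Nat.factorial_ne_zero _)
      have h3 : (m.factorial : ℂ) ≠ 0 := Nat.cast_ne_zero.2 (Nat.factorial_ne_zero _)
      field_simp
    calc C (((l + m).factorial : ℂ)⁻¹) * (T ^ l * P ^ m * C (((l + m).choose l : ℕ) : ℂ))
        = C ((((l + m).choose l : ℕ) : ℂ) * (((l + m).factorial : ℂ)⁻¹)) * (P ^ m * T ^ l) := by
          simp only [map_mul]; ring
      _ = C ((l.factorial : ℂ)⁻¹) * (C ((m.factorial : ℂ)⁻¹) * P ^ m * T ^ l) := by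
          rw [hchoose, map_mul]; ring
  · intro n l
    simp only [Finset.mem_range, Finset.mem_Ico]
    omega

omit [NeZero L] in
/-- Tails of the truncated exponential are null: for constant-free `P`,
`e_M^P - e_{M'}^P` (`M' ≤ M`) has all monomials of degree `> M'`.
[cite: SalmhoferSeiler1991, Remark 3.2] -/
theorem minDegree_eT_sub_eT {P : FieldAlg ν L} (hP : coeff 0 P = 0) {M M' : ℕ} (h : M' ≤ M) :
    MinDegree (M' + 1) (eT M P - eT M' P) := by
  unfold eT
  rw [← Finset.sum_range_add_sum_Ico _ (Nat.succ_le_succ h), add_sub_cancel_left]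
  refine MinDegree.sum fun n hn => ?_
  have hn' : M' + 1 ≤ n := (Finset.mem_Ico.1 hn).1
  refine MinDegree.mul_left _ ?_
  simpa using ((MinDegree.one_of_coeff_zero hP).pow n).mono (by simpa using hn')

omit [NeZero L] in
/-- **Multiplicativity of the truncated exponential modulo null observables**: for constant-free
`P, T`, `e_D^{P+T} ≡ e_D^P · e_D^T` modulo monomials of degree `> D`.
[cite: SalmhoferSeiler1991, Thm. 3.20 (proof)] -/
theorem eT_add_nullEq (D : ℕ) {P T : FieldAlg ν L} (hP : coeff 0 P = 0) (hT : coeff 0 T = 0) :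
    NullEq D (eT D (P + T)) (eT D P * eT D T) := by
  rw [eT_add_eq]
  -- `e_D^P · e_D^T = ∑_l (1/l!) e_D^P T^l`
  have hprod : eT D P * eT D T = ∑ l ∈ range (D + 1), C ((l.factorial : ℂ)⁻¹) * (eT D P * T ^ l) := by
    conv_lhs => rw [show eT D T = ∑ l ∈ range (D + 1), C ((l.factorial : ℂ)⁻¹) * T ^ l from rfl]
    rw [Finset.mul_sum]
    refine Finset.sum_congr rfl fun l _ => ?_
    ring
  rw [hprod]
  refine NullEq.sum fun l hl => ?_
  have hlD : l ≤ D := Nat.lt_succ_iff.1 (Finset.mem_range.1 hl)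
  -- the difference `(e_{D-l}^P - e_D^P) T^l / l!` has degree `> D`
  show MinDegree (D + 1) _
  rw [← mul_sub, ← sub_mul]
  refine MinDegree.mul_left _ ?_
  have h1 : MinDegree (D - l + 1) (eT (D - l) P - eT D P) := by
    have := minDegree_eT_sub_eT hP (Nat.sub_le D l)
    intro m hm
    have hm' : m ∈ (eT D P - eT (D - l) P).support := by
      rw [show eT D P - eT (D - l) P = -(eT (D - l) P - eT D P) by ring, support_neg]; exact hm
    exact this m hm'
  have h2 : MinDegree l (T ^ l) := by simpa using (MinDegree.one_of_coeff_zero hT).pow l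
  exact (h1.mul h2).mono (by omega)

omit [NeZero L] in
/-- **The truncated exponential of a finite sum of constant-free observables is congruent to the
product of the truncated exponentials.** [cite: SalmhoferSeiler1991, Thm. 3.20 (proof)] -/
theorem eT_sum_nullEq (D : ℕ) {α : Type*} (s : Finset α) {t : α → FieldAlg ν L}
    (ht : ∀ a ∈ s, coeff 0 (t a) = 0) :
    NullEq D (eT D (∑ a ∈ s, t a)) (∏ a ∈ s, eT D (t a)) := by
  classical
  induction s using Finset.induction_on with
  | empty =>
    simp only [Finset.sum_empty, Finset.prod_empty]
    have : eT D (0 : FieldAlg ν L) = 1 := by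
      unfold eT
      rw [Finset.sum_range_succ', pow_zero, Nat.factorial_zero]
      simp
    rw [this]
    exact NullEq.refl _
  | insert a s ha ih =>
    rw [Finset.sum_insert ha, Finset.prod_insert ha]
    have hs : coeff 0 (∑ x ∈ s, t x) = 0 := by
      rw [coeff_sum]; exact Finset.sum_eq_zero fun x hx => ht x (Finset.mem_insert_of_mem hx)
    exact (eT_add_nullEq D (ht a (Finset.mem_insert_self a s)) hs).trans
      ((NullEq.refl _).mul (ih fun x hx => ht x (Finset.mem_insert_of_mem hx)))

/-- **The exponential bracket of a family depends only on the sum of the family**: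
`[1 · ∏_j e^{Q_j}]_Λ = e^{∑_j q_j} [e_D^{∑_j (Q_j - q_j)}]_Λ`.
[cite: SalmhoferSeiler1991, Thm. 3.20 (proof)] -/
theorem expBracketC_one_eq {N : ℕ} (f b : ℕ → ℝ) {ι : Type*} [Fintype ι]
    (Q : ι → FieldAlg ν L) :
    expBracketC N f b 1 Q =
      Complex.exp (∑ j, cst (Q j)) * bracketC N f b (eT (topDegree ν L N) (∑ j, tail (Q j))) := by
  rw [expBracketC, Complex.exp_sum, bracketC_congr_of_nullEq f b
    (eT_sum_nullEq (topDegree ν L N) Finset.univ (fun j _ => coeff_zero_tail (Q j))).symm 1, one_mul]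

/-! ### The quadratic form `-N H^ε_Λ(φ)` as a family of site and link terms -/

/-- The site term `-N ε ν (σ_x - φ_x)²` of `-N H^ε_Λ(φ)` ((3.79) expanded as in (3.85): every site
lies on `2ν` links). [cite: SalmhoferSeiler1991, (3.79) and (3.85)] -/
def siteTerm (ε : ℤ) (N : ℕ) (φ : TorusSite ν L → ℂ) (x : TorusSite ν L) : FieldAlg ν L :=
  C (-((N : ℂ) * (ε : ℂ) * (ν : ℂ))) * (X x - C (φ x)) ^ 2

/-- The link term `N (σ_x - φ_x)(σ_{x+e_μ} - φ_{x+e_μ})` of `-N H^ε_Λ(φ)` (sign independent of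
`ε`, (3.85)). [cite: SalmhoferSeiler1991, (3.79) and (3.85)] -/
def linkTerm (N : ℕ) (φ : TorusSite ν L → ℂ) (xμ : TorusSite ν L × Fin ν) : FieldAlg ν L :=
  C (N : ℂ) * ((X xμ.1 - C (φ xμ.1)) * (X (xμ.1 + Pi.single xμ.2 1) - C (φ (xμ.1 + Pi.single xμ.2 1))))

/-- The family of all site and link terms of `-N H^ε_Λ(φ)`, indexed by `Λ ⊕ (Λ × {1,…,ν})`.
[cite: SalmhoferSeiler1991, (3.79) and (3.85)] -/
def hamFamily (ε : ℤ) (N : ℕ) (φ : TorusSite ν L → ℂ) :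
    TorusSite ν L ⊕ TorusSite ν L × Fin ν → FieldAlg ν L :=
  Sum.elim (siteTerm ε N φ) (linkTerm N φ)

/-- `-N H^ε_Λ(φ) = -N (ε/2) ∑_{x,μ} ((σ_x - φ_x) - ε (σ_{x+e_μ} - φ_{x+e_μ}))²` as an observable
(3.79). [cite: SalmhoferSeiler1991, (3.79)] -/
def negNHam (ε : ℤ) (N : ℕ) (φ : TorusSite ν L → ℂ) : FieldAlg ν L :=
  C (-((N : ℂ) * (ε : ℂ) / 2)) * ∑ x : TorusSite ν L, ∑ μ : Fin ν,
    ((X x - C (φ x)) - C (ε : ℂ) * (X (x + Pi.single μ 1) - C (φ (x + Pi.single μ 1)))) ^ 2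

/-- **The partition function with twisted boundary field** `Z^ε_Λ(φ) = [e^{-N H^ε_Λ(φ)}]_Λ` (3.80)
for the background bracket `[·]_Λ` with site data `f` and bond data `b` (3.78), rendered through
the exponential bracket of the family of site and link terms of `-N H^ε_Λ(φ)`.
[cite: SalmhoferSeiler1991, (3.80)] -/
def twistedZ (ε : ℤ) (N : ℕ) (f b : ℕ → ℝ) (φ : TorusSite ν L → ℂ) : ℂ :=
  expBracketC N f b 1 (hamFamily ε N φ)

/-- **(3.79) = (3.85)**: for `ε = ±1` the sum of the site and link terms is `-N H^ε_Λ(φ)`: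
`-N (ε/2) ∑_{x,μ} ((σ_x-φ_x) - ε(σ_{x+e_μ}-φ_{x+e_μ}))² = ∑_x (-Nεν)(σ_x-φ_x)² + ∑_{x,μ} N (σ_x-φ_x)(σ_{x+e_μ}-φ_{x+e_μ})`
(every site is an endpoint of `2ν` links of the torus). [cite: SalmhoferSeiler1991, (3.79) and (3.85)] -/
theorem sum_hamFamily (ε : ℤ) (hε : ε = 1 ∨ ε = -1) (N : ℕ) (φ : TorusSite ν L → ℂ) :
    ∑ j, hamFamily ε N φ j = negNHam ε N φ := by
  -- abbreviations: the site polynomial `s x = σ_x - φ_x` and the link polynomial `u x μ`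
  set s : TorusSite ν L → FieldAlg ν L := fun x => X x - C (φ x) with hs
  set S : FieldAlg ν L := ∑ x, s x ^ 2 with hS
  set B : FieldAlg ν L := ∑ x, ∑ μ : Fin ν, s x * s (x + Pi.single μ 1) with hB
  have hε2 : (C (ε : ℂ) : FieldAlg ν L) ^ 2 = 1 := by
    rcases hε with h | h <;> simp [h]
  have h2 : (C ((2 : ℂ)⁻¹) : FieldAlg ν L) * 2 = 1 := by
    rw [← map_ofNat C 2, ← map_mul, inv_mul_cancel₀ two_ne_zero, map_one]
  -- left side
  have hL : ∑ j, hamFamily ε N φ j =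
      -(C (N : ℂ) * C (ε : ℂ) * C (ν : ℂ)) * S + C (N : ℂ) * B := by
    rw [Fintype.sum_sum_type]
    simp only [hamFamily, Sum.elim_inl, Sum.elim_inr, Fintype.sum_prod_type, siteTerm, linkTerm]
    rw [hS, hB, Finset.mul_sum, Finset.mul_sum]
    congr 1
    · refine Finset.sum_congr rfl fun x _ => ?_
      simp only [map_neg, map_mul, hs]
    · refine Finset.sum_congr rfl fun x _ => ?_
      rw [Finset.mul_sum]
  -- right side: expand the square and re-index the shifted site sum
  have hsq : ∀ (x : TorusSite ν L) (μ : Fin ν),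
      ((X x - C (φ x)) - C (ε : ℂ) * (X (x + Pi.single μ 1) - C (φ (x + Pi.single μ 1)))) ^ 2 =
        s x ^ 2 + C (ε : ℂ) ^ 2 * s (x + Pi.single μ 1) ^ 2 -
          2 * C (ε : ℂ) * (s x * s (x + Pi.single μ 1)) := by
    intro x μ; simp only [hs]; ring
  have hshift : ∀ μ : Fin ν, ∑ x : TorusSite ν L, s (x + Pi.single μ 1) ^ 2 = S := fun μ =>
    Fintype.sum_equiv (Equiv.addRight (Pi.single μ 1)) _ _ fun x => rfl
  have hinner : (∑ x : TorusSite ν L, ∑ μ : Fin ν,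
      ((X x - C (φ x)) - C (ε : ℂ) * (X (x + Pi.single μ 1) - C (φ (x + Pi.single μ 1)))) ^ 2) =
      (ν : FieldAlg ν L) * S + (ν : FieldAlg ν L) * S - 2 * C (ε : ℂ) * B := by
    simp_rw [hsq, hε2, one_mul, Finset.sum_sub_distrib, Finset.sum_add_distrib]
    have e1 : ∑ x : TorusSite ν L, ∑ μ : Fin ν, s x ^ 2 = (ν : FieldAlg ν L) * S := by
      rw [hS, Finset.mul_sum]
      refine Finset.sum_congr rfl fun x _ => ?_
      rw [Finset.sum_const, Finset.card_univ, Fintype.card_fin, nsmul_eq_mul]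
    have e2 : ∑ x : TorusSite ν L, ∑ μ : Fin ν, s (x + Pi.single μ 1) ^ 2 = (ν : FieldAlg ν L) * S := by
      calc ∑ x : TorusSite ν L, ∑ μ : Fin ν, s (x + Pi.single μ 1) ^ 2
          = ∑ μ : Fin ν, ∑ x : TorusSite ν L, s (x + Pi.single μ 1) ^ 2 := Finset.sum_comm
        _ = ∑ μ : Fin ν, S := Finset.sum_congr rfl fun μ _ => hshift μ
        _ = (ν : FieldAlg ν L) * S := by
          rw [Finset.sum_const, Finset.card_univ, Fintype.card_fin, nsmul_eq_mul]
    have e3 : ∑ x : TorusSite ν L, ∑ μ : Fin ν, 2 * C (ε : ℂ) * (s x * s (x + Pi.single μ 1)) =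
        2 * C (ε : ℂ) * B := by
      rw [hB, Finset.mul_sum]
      refine Finset.sum_congr rfl fun x _ => ?_
      rw [Finset.mul_sum]
    rw [e1, e2, e3]
  have hR : negNHam ε N φ =
      -(C (N : ℂ) * C (ε : ℂ) * C ((2 : ℂ)⁻¹)) * ((ν : FieldAlg ν L) * S + (ν : FieldAlg ν L) * S -
        2 * C (ε : ℂ) * B) := by
    have hc : C (-((N : ℂ) * (ε : ℂ) / 2)) = -(C (N : ℂ) * C (ε : ℂ) * C ((2 : ℂ)⁻¹) : FieldAlg ν L) := by
      rw [div_eq_mul_inv, map_neg, map_mul, map_mul]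
    rw [negNHam, hinner, hc]
  rw [hL, hR, ← map_natCast C ν]
  linear_combination (C (N : ℂ) * C (ε : ℂ) * C (ν : ℂ) * S - C (N : ℂ) * B) * h2 +
    (-(2 : FieldAlg ν L) * C (N : ℂ) * C ((2 : ℂ)⁻¹) * B) * hε2

/-- **`Z^ε_Λ(φ) = e^{k₀(φ)} [e_D^{K(φ) - k₀(φ)}]_Λ`**, `K(φ) = -N H^ε_Λ(φ)`, `k₀` its constant term:
the twisted partition function depends on `φ` only through the observable `-N H^ε_Λ(φ)` (3.80).
[cite: SalmhoferSeiler1991, (3.80)] -/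
theorem twistedZ_eq (ε : ℤ) (hε : ε = 1 ∨ ε = -1) (N : ℕ) (f b : ℕ → ℝ) (φ : TorusSite ν L → ℂ) :
    twistedZ ε N f b φ =
      Complex.exp (cst (negNHam ε N φ)) * bracketC N f b (eT (topDegree ν L N) (tail (negNHam ε N φ))) := by
  rw [twistedZ, expBracketC_one_eq, ← sum_hamFamily ε hε N φ]
  congr 2
  · simp [cst, coeff_sum]
  · simp only [tail, coeff_sum, map_sum, Finset.sum_sub_distrib]

/-! ### Homogeneous configurations: `Z^ε_Λ(Φ^{(x)}) = Z^ε_Λ(0)` ((3.94), (3.96)) -/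

/-- **The site parity** `∑_j y_j mod 2` on the even torus (`Λ_e` / `Λ_o` of (3.93)).
[cite: SalmhoferSeiler1991, (3.93)] -/
def parity (hL : 2 ∣ L) (y : TorusSite ν L) : ZMod 2 := ∑ j, ZMod.castHom hL (ZMod 2) (y j)

omit [NeZero L] in
/-- Neighbours have opposite parity (even side). [cite: SalmhoferSeiler1991, (3.93)] -/
theorem parity_add_single (hL : 2 ∣ L) (y : TorusSite ν L) (μ : Fin ν) :
    parity hL (y + Pi.single μ 1) = parity hL y + 1 := by
  unfold parity
  rw [← Finset.sum_erase_add _ _ (Finset.mem_univ μ), ← Finset.sum_erase_add _ (fun j => ZMod.castHom hL (ZMod 2) (y j)) (Finset.mem_univ μ), add_assoc]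
  congr 1
  · refine Finset.sum_congr rfl fun j hj => ?_
    rw [Pi.add_apply, Pi.single_eq_of_ne (Finset.ne_of_mem_erase hj), add_zero]
  · rw [Pi.add_apply, Pi.single_eq_same, map_add, map_one]

/-- **The homogeneous configuration** `Φ^{(x)}` of (3.93) built from one value `c`: `c` on the sites
of the parity `p₀` of `x`, `conj c` on the others. [cite: SalmhoferSeiler1991, (3.93)] -/
def pattern (hL : 2 ∣ L) (c : ℂ) (p₀ : ZMod 2) : TorusSite ν L → ℂ :=
  fun y => if parity hL y = p₀ then c else starRingEnd ℂ c

omit [NeZero L] in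
/-- On neighbouring sites the homogeneous configuration takes the values `c` and `conj c` (in some
order), so for `c ∈ iℝ` their sum vanishes: the configuration is staggered (3.95)–(3.96).
[cite: SalmhoferSeiler1991, (3.96)] -/
theorem pattern_add_pattern_neighbour (hL : 2 ∣ L) {c : ℂ} (hc : starRingEnd ℂ c = -c)
    (p₀ : ZMod 2) (y : TorusSite ν L) (μ : Fin ν) :
    pattern hL c p₀ y + pattern hL c p₀ (y + Pi.single μ 1) = 0 := by
  unfold pattern
  rw [parity_add_single]
  by_cases h : parity hL y = p₀
  · have h' : parity hL y + 1 ≠ p₀ := by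
      rw [← h]; intro h''
      have : (1 : ZMod 2) = 0 := by simp at h''
      exact one_ne_zero this
    rw [if_pos h, if_neg h', hc, add_neg_cancel]
  · have h' : parity hL y + 1 = p₀ := by
      have h2 : ∀ a b : ZMod 2, a ≠ b → a + 1 = b := by decide
      exact h2 _ _ h
    rw [if_neg h, if_pos h', hc, neg_add_cancel]

/-- **`H⁺_Λ(Φ) = H⁺_Λ(0)` for a constant real configuration** (3.94): `(σ_x - c) - (σ_y - c) = σ_x - σ_y`.
[cite: SalmhoferSeiler1991, (3.94)] -/
theorem negNHam_one_const (N : ℕ) (c : ℂ) :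
    negNHam (ν := ν) (L := L) 1 N (fun _ => c) = negNHam 1 N (fun _ => 0) := by
  unfold negNHam
  refine congrArg (HMul.hMul _) ?_
  refine Finset.sum_congr rfl fun x _ => Finset.sum_congr rfl fun μ _ => ?_
  simp only [Int.cast_one, map_one, one_mul, map_zero, sub_zero]
  ring

/-- **`H⁻_Λ(Φ) = H⁻_Λ(0)` for a staggered imaginary configuration** ((3.96): "since `H⁻_Λ` is
formally antiferromagnetic"): `(σ_x - Φ_x) + (σ_y - Φ_y) = σ_x + σ_y` on every link.
[cite: SalmhoferSeiler1991, (3.96)] -/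
theorem negNHam_negOne_pattern (hL : 2 ∣ L) (N : ℕ) {c : ℂ} (hc : starRingEnd ℂ c = -c)
    (p₀ : ZMod 2) :
    negNHam (ν := ν) (L := L) (-1) N (pattern hL c p₀) = negNHam (-1) N (fun _ => 0) := by
  unfold negNHam
  refine congrArg (HMul.hMul _) ?_
  refine Finset.sum_congr rfl fun x _ => Finset.sum_congr rfl fun μ _ => ?_
  have h := pattern_add_pattern_neighbour (ν := ν) hL hc p₀ x μ
  have h' : (C (pattern hL c p₀ (x + Pi.single μ 1)) : FieldAlg ν L) = -C (pattern hL c p₀ x) := by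
    rw [← map_neg]; congr 1; linear_combination h
  simp only [Int.cast_neg, Int.cast_one, map_neg, map_one, neg_mul, one_mul, sub_neg_eq_add,
    map_zero, sub_zero, h']
  ring

/-- **Gaussian domination, the homogeneous case `ε = 1`**: `Z⁺_Λ(c) = Z⁺_Λ(0)` for a constant
configuration. [cite: SalmhoferSeiler1991, (3.94)] -/
theorem twistedZ_one_const (N : ℕ) (f b : ℕ → ℝ) (c : ℂ) :
    twistedZ (ν := ν) (L := L) 1 N f b (fun _ => c) =
      twistedZ (ν := ν) (L := L) 1 N f b (fun _ => 0) := by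
  rw [twistedZ_eq (ν := ν) (L := L) 1 (Or.inl rfl) N f b, twistedZ_eq (ν := ν) (L := L) 1 (Or.inl rfl) N f b,
    negNHam_one_const]

/-- **Gaussian domination, the homogeneous case `ε = -1`**: `Z⁻_Λ(Φ) = Z⁻_Λ(0)` for the staggered
configuration built from an imaginary value (3.96). [cite: SalmhoferSeiler1991, (3.96)] -/
theorem twistedZ_negOne_pattern (hL : 2 ∣ L) (N : ℕ) (f b : ℕ → ℝ) {c : ℂ}
    (hc : starRingEnd ℂ c = -c) (p₀ : ZMod 2) :
    twistedZ (ν := ν) (L := L) (-1) N f b (pattern hL c p₀) =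
      twistedZ (ν := ν) (L := L) (-1) N f b (fun _ => 0) := by
  rw [twistedZ_eq (ν := ν) (L := L) (-1) (Or.inr rfl) N f b,
    twistedZ_eq (ν := ν) (L := L) (-1) (Or.inr rfl) N f b, negNHam_negOne_pattern hL N hc]

/-! ### The chessboard argument for configurations (maximiser form of [19], (3.89)–(3.93)) -/

section Chessboard

omit [NeZero L] in
/-- The reflection flips the site parity (even side). [cite: SalmhoferSeiler1991, (3.93)] -/
theorem parity_siteReflect (hL : 2 ∣ L) (i : Fin ν) (k : ZMod L) (y : TorusSite ν L) :
    parity hL (siteReflect i k y) = parity hL y + 1 := by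
  unfold parity
  rw [← Finset.sum_erase_add _ _ (Finset.mem_univ i),
    ← Finset.sum_erase_add _ (fun j => ZMod.castHom hL (ZMod 2) (y j)) (Finset.mem_univ i), add_assoc]
  congr 1
  · refine Finset.sum_congr rfl fun j hj => ?_
    rw [siteReflect_apply_of_ne _ _ _ (Finset.ne_of_mem_erase hj)]
  · rw [siteReflect_apply_same, map_sub, map_sub, map_mul, map_ofNat, map_one]
    have h : ∀ a b : ZMod 2, 2 * b - 1 - a = a + 1 := by decide
    exact h _ _

omit [NeZero L] in
/-- The homogeneous configuration is conjugated by the reflection: `Φ(r y) = conj Φ(y)`.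
[cite: SalmhoferSeiler1991, (3.93)] -/
theorem pattern_siteReflect (hL : 2 ∣ L) (c : ℂ) (p₀ : ZMod 2) (i : Fin ν) (k : ZMod L)
    (y : TorusSite ν L) :
    pattern hL c p₀ (siteReflect i k y) = starRingEnd ℂ (pattern hL c p₀ y) := by
  unfold pattern
  rw [parity_siteReflect]
  by_cases h : parity hL y = p₀
  · have h' : parity hL y + 1 ≠ p₀ := by
      rw [← h]; intro h''
      have : (1 : ZMod 2) = 0 := by simp at h''
      exact one_ne_zero this
    rw [if_neg h', if_pos h]
  · have h' : parity hL y + 1 = p₀ := by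
      have h2 : ∀ a b : ZMod 2, a ≠ b → a + 1 = b := by decide
      exact h2 _ _ h
    rw [if_pos h', if_neg h, starRingEnd_self_apply]

/-- **The positive symmetrisation of a configuration** `φ ↦ (φ on Λ₊, conj φ∘r on Λ₋)` — the
configuration whose twisted partition function is the first factor of (3.90).
[cite: SalmhoferSeiler1991, (3.90)] -/
def cfgSymP (i : Fin ν) (k : ZMod L) (ψ : TorusSite ν L → ℂ) : TorusSite ν L → ℂ :=
  fun y => if y ∈ halfPlus L i k then ψ y else starRingEnd ℂ (ψ (siteReflect i k y))

/-- **The negative symmetrisation** `φ ↦ (conj φ∘r on Λ₊, φ on Λ₋)` (second factor of (3.90)).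
[cite: SalmhoferSeiler1991, (3.90)] -/
def cfgSymM (i : Fin ν) (k : ZMod L) (ψ : TorusSite ν L → ℂ) : TorusSite ν L → ℂ :=
  fun y => if y ∈ halfMinus L i k then ψ y else starRingEnd ℂ (ψ (siteReflect i k y))

/-- Symmetrisation keeps the values in a conjugation-closed set. [cite: SalmhoferSeiler1991, (3.90)] -/
theorem cfgSymP_mem {S : Finset ℂ} (hS : ∀ c ∈ S, starRingEnd ℂ c ∈ S) (i : Fin ν) (k : ZMod L)
    {ψ : TorusSite ν L → ℂ} (hψ : ∀ y, ψ y ∈ S) (y : TorusSite ν L) : cfgSymP i k ψ y ∈ S := by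
  unfold cfgSymP; split_ifs
  · exact hψ y
  · exact hS _ (hψ _)

/-- Symmetrisation keeps the values in a conjugation-closed set. [cite: SalmhoferSeiler1991, (3.90)] -/
theorem cfgSymM_mem {S : Finset ℂ} (hS : ∀ c ∈ S, starRingEnd ℂ c ∈ S) (i : Fin ν) (k : ZMod L)
    {ψ : TorusSite ν L → ℂ} (hψ : ∀ y, ψ y ∈ S) (y : TorusSite ν L) : cfgSymM i k ψ y ∈ S := by
  unfold cfgSymM; split_ifs
  · exact hψ y
  · exact hS _ (hψ _)

/-- The set of sites where a configuration agrees with a reference configuration.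
[cite: SalmhoferSeiler1991, (3.92)–(3.93)] -/
def agree (Φ ψ : TorusSite ν L → ℂ) : Finset (TorusSite ν L) :=
  Finset.univ.filter fun y => ψ y = Φ y

/-- Membership in the agreement set. [cite: SalmhoferSeiler1991, (3.92)–(3.93)] -/
@[simp] theorem mem_agree {Φ ψ : TorusSite ν L → ℂ} {y : TorusSite ν L} :
    y ∈ agree Φ ψ ↔ ψ y = Φ y := by
  simp [agree]

/-- **Agreement propagates under the positive symmetrisation**: if `ψ = Φ` on `A`, then
`cfgSymP ψ = Φ` on `(A ∩ Λ₊) ∪ r(A ∩ Λ₊)`, for a reference `Φ` with `Φ ∘ r = conj ∘ Φ`.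
[cite: SalmhoferSeiler1991, (3.91)–(3.93)] -/
theorem symP_agree_subset (hL : Even L) {Φ : TorusSite ν L → ℂ}
    (hΦ : ∀ (i : Fin ν) (k : ZMod L) (y : TorusSite ν L),
      Φ (siteReflect i k y) = starRingEnd ℂ (Φ y))
    (i : Fin ν) (k : ZMod L) (ψ : TorusSite ν L → ℂ) :
    symP i k (agree Φ ψ) ⊆ agree Φ (cfgSymP i k ψ) := by
  intro z hz
  rw [symP, Finset.mem_union, Finset.mem_inter, Finset.mem_image] at hz
  rw [mem_agree, cfgSymP]
  rcases hz with ⟨hzA, hzP⟩ | ⟨y, hy, rfl⟩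
  · rw [if_pos hzP]; exact mem_agree.1 hzA
  · rw [Finset.mem_inter] at hy
    have hz : siteReflect i k y ∉ halfPlus L i k := fun h =>
      (disjoint_halfPlus_halfMinus i k |> Finset.disjoint_left.1) h (cellReflect_mem_halfMinus hL hy.2)
    rw [if_neg hz]
    change starRingEnd ℂ (ψ (siteReflect i k (siteReflect i k y))) = Φ (siteReflect i k y)
    rw [siteReflect_siteReflect, mem_agree.1 hy.1, hΦ]

/-- **Agreement propagates under the negative symmetrisation.** [cite: SalmhoferSeiler1991, (3.91)–(3.93)] -/
theorem symM_agree_subset (hL : Even L) {Φ : TorusSite ν L → ℂ}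
    (hΦ : ∀ (i : Fin ν) (k : ZMod L) (y : TorusSite ν L),
      Φ (siteReflect i k y) = starRingEnd ℂ (Φ y))
    (i : Fin ν) (k : ZMod L) (ψ : TorusSite ν L → ℂ) :
    symM i k (agree Φ ψ) ⊆ agree Φ (cfgSymM i k ψ) := by
  intro z hz
  rw [symM, Finset.mem_union, Finset.mem_inter, Finset.mem_image] at hz
  rw [mem_agree, cfgSymM]
  rcases hz with ⟨hzA, hzM⟩ | ⟨y, hy, rfl⟩
  · rw [if_pos hzM]; exact mem_agree.1 hzA
  · rw [Finset.mem_inter] at hy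
    have hz : siteReflect i k y ∉ halfMinus L i k := fun h =>
      (disjoint_halfPlus_halfMinus i k |> Finset.disjoint_left.1) (cellReflect_mem_halfPlus hL hy.2) h
    rw [if_neg hz]
    change starRingEnd ℂ (ψ (siteReflect i k (siteReflect i k y))) = Φ (siteReflect i k y)
    rw [siteReflect_siteReflect, mem_agree.1 hy.1, hΦ]

variable {S : Finset ℂ} {F : (TorusSite ν L → ℂ) → ℝ}

/-- **Symmetrisations of maximisers are maximisers** (the reflection Schwarz inequality (3.90) in
the maximiser form of the chessboard argument). [cite: SalmhoferSeiler1991, (3.90)–(3.91)] -/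
theorem isMax_cfgSymP (hS : ∀ c ∈ S, starRingEnd ℂ c ∈ S) (h0 : ∀ ψ, 0 ≤ F ψ)
    (hcs : ∀ (i : Fin ν) (k : ZMod L) (ψ : TorusSite ν L → ℂ), (∀ y, ψ y ∈ S) →
      F ψ ^ 2 ≤ F (cfgSymP i k ψ) * F (cfgSymM i k ψ))
    {M : ℝ} (hMpos : 0 < M) (hmax : ∀ ψ : TorusSite ν L → ℂ, (∀ y, ψ y ∈ S) → F ψ ≤ M)
    {ψ : TorusSite ν L → ℂ} (hψ : ∀ y, ψ y ∈ S) (hψM : F ψ = M) (i : Fin ν) (k : ZMod L) :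
    F (cfgSymP i k ψ) = M ∧ F (cfgSymM i k ψ) = M := by
  have h := hcs i k ψ hψ
  rw [hψM] at h
  have hP := hmax _ (cfgSymP_mem hS i k hψ)
  have hM' := hmax _ (cfgSymM_mem hS i k hψ)
  have hP0 := h0 (cfgSymP i k ψ)
  have hM0 := h0 (cfgSymM i k ψ)
  constructor
  · refine le_antisymm hP ?_
    by_contra hlt
    rw [not_le] at hlt
    nlinarith
  · refine le_antisymm hM' ?_
    by_contra hlt
    rw [not_le] at hlt
    nlinarith

/-- **Doubling a run of agreement inside a maximiser.** [cite: SalmhoferSeiler1991, (3.91)] -/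
theorem exists_isMax_axisRun_succ_cfg (hL : Even L) (hS : ∀ c ∈ S, starRingEnd ℂ c ∈ S)
    (h0 : ∀ ψ, 0 ≤ F ψ)
    (hcs : ∀ (i : Fin ν) (k : ZMod L) (ψ : TorusSite ν L → ℂ), (∀ y, ψ y ∈ S) →
      F ψ ^ 2 ≤ F (cfgSymP i k ψ) * F (cfgSymM i k ψ))
    {M : ℝ} (hMpos : 0 < M) (hmax : ∀ ψ : TorusSite ν L → ℂ, (∀ y, ψ y ∈ S) → F ψ ≤ M)
    {Φ : TorusSite ν L → ℂ}
    (hΦ : ∀ (i : Fin ν) (k : ZMod L) (y : TorusSite ν L), Φ (siteReflect i k y) = starRingEnd ℂ (Φ y))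
    {t₀ : TorusSite ν L} {i : Fin ν} {j : ℕ} (hj : 2 ^ (j + 1) ≤ L)
    {ψ : TorusSite ν L → ℂ} (hψ : ∀ y, ψ y ∈ S) (hψM : F ψ = M)
    (hrun : axisRun t₀ i j ⊆ agree Φ ψ) :
    ∃ ψ' : TorusSite ν L → ℂ, (∀ y, ψ' y ∈ S) ∧ F ψ' = M ∧ axisRun t₀ i (j + 1) ⊆ agree Φ ψ' := by
  set k : ZMod L := t₀ i + ((2 ^ j : ℕ) : ZMod L) with hk
  have hj' : 2 ^ j ≤ L / 2 := by rw [pow_succ] at hj; omega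
  refine ⟨cfgSymM i k ψ, cfgSymM_mem hS i k hψ, (isMax_cfgSymP hS h0 hcs hMpos hmax hψ hψM i k).2,
    fun c hc => symM_agree_subset hL hΦ i k ψ ?_⟩
  rcases mem_axisRun_succ hj hc with h | h
  · exact mem_symM_of_mem i k (hrun h) (axisRun_subset_halfMinus hj' t₀ i h)
  · have := cellReflect_mem_symM_of_mem i k (hrun h) (axisRun_subset_halfMinus hj' t₀ i h)
    rwa [cellReflect_cellReflect] at this

/-- **Growing a maximiser along one axis** (any even side): from agreement on `boxRun t₀ i` to
agreement on `boxRun t₀ (i+1)`. [cite: SalmhoferSeiler1991, (3.91)–(3.92)] -/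
theorem exists_isMax_boxRun_succ_cfg (hL : Even L) (hS : ∀ c ∈ S, starRingEnd ℂ c ∈ S)
    (h0 : ∀ ψ, 0 ≤ F ψ)
    (hcs : ∀ (i : Fin ν) (k : ZMod L) (ψ : TorusSite ν L → ℂ), (∀ y, ψ y ∈ S) →
      F ψ ^ 2 ≤ F (cfgSymP i k ψ) * F (cfgSymM i k ψ))
    {M : ℝ} (hMpos : 0 < M) (hmax : ∀ ψ : TorusSite ν L → ℂ, (∀ y, ψ y ∈ S) → F ψ ≤ M)
    {Φ : TorusSite ν L → ℂ}
    (hΦ : ∀ (i : Fin ν) (k : ZMod L) (y : TorusSite ν L), Φ (siteReflect i k y) = starRingEnd ℂ (Φ y))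
    {t₀ : TorusSite ν L} (i : Fin ν) {ψ : TorusSite ν L → ℂ} (hψ : ∀ y, ψ y ∈ S) (hψM : F ψ = M)
    (hbox : boxRun t₀ i.val ⊆ agree Φ ψ) :
    ∃ ψ' : TorusSite ν L → ℂ, (∀ y, ψ' y ∈ S) ∧ F ψ' = M ∧ boxRun t₀ (i.val + 1) ⊆ agree Φ ψ' := by
  have hN2 : 1 ≤ L / 2 := by
    obtain ⟨m, hm⟩ := hL
    have := NeZero.ne L
    omega
  classical
  let J : ℕ := Nat.findGreatest (fun j => 2 ^ j ≤ L / 2) L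
  have hJle : 2 ^ J ≤ L / 2 := by
    have h0' : (fun j => 2 ^ j ≤ L / 2) 0 := by simpa using hN2
    exact Nat.findGreatest_spec (P := fun j => 2 ^ j ≤ L / 2) (Nat.zero_le L) h0'
  have hJlt : L / 2 < 2 ^ (J + 1) := by
    by_contra hle
    rw [not_lt] at hle
    have hJ1N : J + 1 ≤ L := by
      have h2 : 2 ^ (J + 1) ≤ L := hle.trans (Nat.div_le_self L 2)
      have h3 := Nat.lt_two_pow_self (n := J + 1)
      omega
    have := Nat.le_findGreatest (P := fun j => 2 ^ j ≤ L / 2) hJ1N hle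
    change J + 1 ≤ J at this
    omega
  have key : ∀ j : ℕ, j ≤ J + 1 →
      ∃ ψ' : TorusSite ν L → ℂ, (∀ y, ψ' y ∈ S) ∧ F ψ' = M ∧ axisRun t₀ i j ⊆ agree Φ ψ' := by
    intro j
    induction j with
    | zero => exact fun _ => ⟨ψ, hψ, hψM, by rw [axisRun_zero]; exact hbox⟩
    | succ j ih =>
      intro hj
      obtain ⟨ψ', hψ', hψ'M, hrun⟩ := ih (Nat.le_of_succ_le hj)
      have h2 : 2 ^ (j + 1) ≤ L := by
        have hjJ : j ≤ J := Nat.le_of_succ_le_succ hj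
        calc 2 ^ (j + 1) = 2 * 2 ^ j := by rw [pow_succ, mul_comm]
          _ ≤ 2 * 2 ^ J := Nat.mul_le_mul_left 2 (Nat.pow_le_pow_right (by norm_num) hjJ)
          _ ≤ 2 * (L / 2) := Nat.mul_le_mul_left 2 hJle
          _ ≤ L := Nat.mul_div_le L 2
      exact exists_isMax_axisRun_succ_cfg hL hS h0 hcs hMpos hmax hΦ h2 hψ' hψ'M hrun
  obtain ⟨ψ', hψ', hψ'M, hrun⟩ := key (J + 1) le_rfl
  -- close the line through the boundary at the start of the run
  refine ⟨cfgSymP i (t₀ i) ψ', cfgSymP_mem hS i (t₀ i) hψ',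
    (isMax_cfgSymP hS h0 hcs hMpos hmax hψ' hψ'M i (t₀ i)).1, ?_⟩
  exact (Literature.Probability.LatticeModels.boxRun_succ_subset_symP hL hJlt.le hrun).trans
    (symP_agree_subset hL hΦ i (t₀ i) ψ')

/-- **The chessboard bound in maximiser form** ((3.91)–(3.93)): for `F ≥ 0` on configurations with
values in a finite conjugation-closed set `S`, satisfying the reflection Schwarz inequalities
`F(ψ)² ≤ F(ψ₊-symmetrised) F(ψ₋-symmetrised)` for all planes, every configuration is dominated by
a homogeneous one: `F(φ) ≤ F(Φ^{(c)})` for some `c ∈ S`, `Φ^{(c)} = c` on one parity class and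
`conj c` on the other. [cite: SalmhoferSeiler1991, (3.92)–(3.93)] -/
theorem chessboard_cfg (hL : Even L) (hS : ∀ c ∈ S, starRingEnd ℂ c ∈ S) (h0 : ∀ ψ, 0 ≤ F ψ)
    (hcs : ∀ (i : Fin ν) (k : ZMod L) (ψ : TorusSite ν L → ℂ), (∀ y, ψ y ∈ S) →
      F ψ ^ 2 ≤ F (cfgSymP i k ψ) * F (cfgSymM i k ψ))
    {φ : TorusSite ν L → ℂ} (hφ : ∀ y, φ y ∈ S) (t₀ : TorusSite ν L) :
    ∃ c ∈ S, ∃ p₀ : ZMod 2, F φ ≤ F (pattern hL.two_dvd c p₀) := by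
  classical
  -- a maximiser over the finite configuration space
  set Ω := Fintype.piFinset fun _ : TorusSite ν L => S with hΩ
  have hφΩ : φ ∈ Ω := Fintype.mem_piFinset.2 hφ
  obtain ⟨ψ, hψΩ, hψmax⟩ := Finset.exists_max_image Ω F ⟨φ, hφΩ⟩
  have hψ : ∀ y, ψ y ∈ S := Fintype.mem_piFinset.1 hψΩ
  set M := F ψ with hM
  have hmax : ∀ ψ' : TorusSite ν L → ℂ, (∀ y, ψ' y ∈ S) → F ψ' ≤ M :=
    fun ψ' hψ' => hψmax ψ' (Fintype.mem_piFinset.2 hψ')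
  have hφM : F φ ≤ M := hmax φ hφ
  -- the homogeneous configuration built from `ψ t₀`
  set c := ψ t₀ with hc
  set Φ := pattern (ν := ν) hL.two_dvd c (parity hL.two_dvd t₀) with hΦdef
  have hΦ : ∀ (i : Fin ν) (k : ZMod L) (y : TorusSite ν L), Φ (siteReflect i k y) = starRingEnd ℂ (Φ y) :=
    fun i k y => pattern_siteReflect hL.two_dvd c _ i k y
  refine ⟨c, hψ t₀, parity hL.two_dvd t₀, ?_⟩
  by_cases hMpos : 0 < M
  · -- grow the agreement set of a maximiser from `{t₀}` to the whole torus
    have grow : ∀ m : ℕ, m ≤ ν →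
        ∃ ψ' : TorusSite ν L → ℂ, (∀ y, ψ' y ∈ S) ∧ F ψ' = M ∧ boxRun t₀ m ⊆ agree Φ ψ' := by
      intro m
      induction m with
      | zero =>
        intro _
        refine ⟨ψ, hψ, rfl, ?_⟩
        rw [boxRun_zero, Finset.singleton_subset_iff, mem_agree, hΦdef, pattern, if_pos rfl]
      | succ m ih =>
        intro hm
        obtain ⟨ψ', hψ', hψ'M, hbox⟩ := ih (Nat.le_of_succ_le hm)
        exact exists_isMax_boxRun_succ_cfg hL hS h0 hcs hMpos hmax hΦ ⟨m, hm⟩ hψ' hψ'M hbox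
    obtain ⟨ψ', -, hψ'M, hbox⟩ := grow ν le_rfl
    rw [boxRun_eq_univ] at hbox
    have hψ'Φ : ψ' = Φ := funext fun y => mem_agree.1 (hbox (Finset.mem_univ y))
    have hΦM : F Φ = M := by rw [← hψ'Φ]; exact hψ'M
    show F φ ≤ F Φ
    rw [hΦM]
    exact hφM
  · exact (hφM.trans (not_lt.1 hMpos)).trans (h0 _)

end Chessboard

/-! ### Towards the per-plane regrouping (3.84)–(3.88): behaviour of the pieces under `Θ` -/

section Regroup

variable {i : Fin ν} {k : ZMod L}

omit [NeZero L] in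
/-- `Θ` conjugates constant terms. [cite: SalmhoferSeiler1991, Def. 3.14 (3.50)] -/
theorem cst_reflect (Q : FieldAlg ν L) : cst (reflect i k Q) = starRingEnd ℂ (cst Q) := by
  have h := coeff_mapDomain_reflect i k Q 0
  rwa [Finsupp.mapDomain_zero] at h

omit [NeZero L] in
/-- `Θ` commutes with taking the constant-free part. [cite: SalmhoferSeiler1991, Def. 3.14 (3.50)] -/
theorem tail_reflect (Q : FieldAlg ν L) : tail (reflect i k Q) = reflect i k (tail Q) := by
  simp only [tail, map_sub, reflect_C, cst_reflect, cst]

omit [NeZero L] in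
/-- The reflected exponential factor: `Θ (e^{q} e_D^{Q - q}) = e^{conj q} e_D^{ΘQ - conj q}`.
[cite: SalmhoferSeiler1991, (3.84)] -/
theorem reflect_expFactor (D : ℕ) (Q : FieldAlg ν L) :
    reflect i k (C (Complex.exp (cst Q)) * eT D (tail Q)) =
      C (Complex.exp (cst (reflect i k Q))) * eT D (tail (reflect i k Q)) := by
  rw [map_mul, reflect_C, reflect_eT, ← tail_reflect, cst_reflect, Complex.exp_conj]

/-- The positive symmetrisation on the positive half. [cite: SalmhoferSeiler1991, (3.90)] -/
theorem cfgSymP_of_mem {ψ : TorusSite ν L → ℂ} {y : TorusSite ν L} (hy : y ∈ halfPlus L i k) :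
    cfgSymP i k ψ y = ψ y := by
  simp [cfgSymP, hy]

/-- The positive symmetrisation on the negative half (even side). [cite: SalmhoferSeiler1991, (3.90)] -/
theorem cfgSymP_of_mem_halfMinus {ψ : TorusSite ν L → ℂ} {y : TorusSite ν L}
    (hy : y ∈ halfMinus L i k) : cfgSymP i k ψ y = starRingEnd ℂ (ψ (siteReflect i k y)) := by
  have : y ∉ halfPlus L i k := (not_mem_halfPlus_iff i k y).2 hy
  simp [cfgSymP, this]

/-- The negative symmetrisation on the negative half. [cite: SalmhoferSeiler1991, (3.90)] -/
theorem cfgSymM_of_mem {ψ : TorusSite ν L → ℂ} {y : TorusSite ν L} (hy : y ∈ halfMinus L i k) :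
    cfgSymM i k ψ y = ψ y := by
  simp [cfgSymM, hy]

/-- The negative symmetrisation on the positive half (even side). [cite: SalmhoferSeiler1991, (3.90)] -/
theorem cfgSymM_of_mem_halfPlus {ψ : TorusSite ν L → ℂ} {y : TorusSite ν L}
    (hy : y ∈ halfPlus L i k) : cfgSymM i k ψ y = starRingEnd ℂ (ψ (siteReflect i k y)) := by
  have : y ∉ halfMinus L i k := fun h => (disjoint_halfPlus_halfMinus i k |> Finset.disjoint_left.1) hy h
  simp [cfgSymM, this]

/-- **The crossing link terms are polarised**: for an upper crossing link `(x, x + eᵢ) = (x, rx)`,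
`N (σ_x - φ_x)(σ_{rx} - φ_{rx}) = N · C_x · ΘD_x` with `C_x = σ_x - φ_x`, `D_x = σ_x - conj φ_{rx}`
((3.87)–(3.88)). [cite: SalmhoferSeiler1991, (3.86)–(3.88)] -/
theorem linkTerm_eq_crossExp (hL : Even L) (N : ℕ) (φ : TorusSite ν L → ℂ) {x : TorusSite ν L}
    (hx : x ∈ halfPlus L i k) (hx' : x + Pi.single i 1 ∈ halfMinus L i k) :
    linkTerm N φ (x, i) =
      crossExp i k (fun _ => (N : ℝ)) (fun y => X y - C (φ y))
        (fun y => X y - C (starRingEnd ℂ (φ (siteReflect i k y)))) x := by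
  simp only [linkTerm, crossExp, map_sub, reflect_X, reflect_C, starRingEnd_self_apply,
    Complex.ofReal_natCast]
  rw [add_single_eq_siteReflect hL hx hx']

/-- The lower crossing link `(x, x + eᵢ)` with `x ∈ Λ₋`, `y = x + eᵢ ∈ Λ₊`, `x = r y`:
`N (σ_{ry} - φ_{ry})(σ_y - φ_y) = N · C_y · ΘD_y`. [cite: SalmhoferSeiler1991, (3.86)–(3.88)] -/
theorem linkTerm_eq_crossExp' (hL : Even L) (N : ℕ) (φ : TorusSite ν L → ℂ) {x : TorusSite ν L}
    (hx : x ∈ halfMinus L i k) (hx' : x + Pi.single i 1 ∈ halfPlus L i k) :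
    linkTerm N φ (x, i) =
      crossExp i k (fun _ => (N : ℝ)) (fun y => X y - C (φ y))
        (fun y => X y - C (starRingEnd ℂ (φ (siteReflect i k y)))) (x + Pi.single i 1) := by
  simp only [linkTerm, crossExp, map_sub, reflect_X, reflect_C, starRingEnd_self_apply,
    Complex.ofReal_natCast]
  rw [← eq_siteReflect_add_single hL hx hx']
  ring

end Regroup

end ComplexSpin

end Literature.MathematicalPhysics.StatisticalMechanics

end
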